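import Mathlib
import HarnessLib
import Summits.Langlands.Langlands.Theses.QuarterDeficit1951
import Summits.Langlands.Langlands.Theorems.QuarterFingerprintDeficit.Negative.FalseWithoutNonzero

/-!
# Birth skeleton (BC3) for crux stmt-Langlands-15897
`Summit.Langlands.Langlands.Theses.QuarterDeficit1951.QuarterFingerprintDeficit` (C1) — line `birth`

Route `route-Langlands-QuarterDeficit1951` (refutation shape, `closes : C1 → C2a → C2b → ¬Langlands`).
C1 is the census bet: for EVERY order-5 Dirichlet character `χ mod 1951` there is NO nonzero bounded `C²`
cuspidal Maass form `u` on `(Γ₀(1951), χ)` in the window `|λ − 1/4| ≤ 1/100` which is a joint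
`T_p`-eigenfunction (`p ≤ 13`, unitary normalisation, nebentypus `χ`) with `dist(μ_p² χ̄(p), Φ) ≤ 1/100`,
`Φ = {0, 1, 4, (3 ± √5)/2}`.

This file is the skeleton that concludes C1 BY NAME from three named stubs, in the only proof shape a
spectral census has (Booker–Strömbergsson 2007, "count + list = completeness"; crux card
`Ideas/count-identify-census.md`): an analytic normalisation lemma, an upper COUNT, and an
IDENTIFICATION of what was counted.

* `stub_heckeReality` (analytic, TRUE in substance): for a nonzero bounded form the Hecke eigenvalue at
  `p ∤ 1951` satisfies `μ_p² χ̄(p) = μ_p μ̄_p` (`T_p* = χ̄(p) T_p` on `L²(Γ₀(1951)\ℍ, χ)`, Petersson pairing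
  over a fundamental domain of covolume `1952π/3`, `‖u‖₂ > 0` because `u` is continuous and `u ≢ 0`). It
  turns the crux's complex fingerprint datum `μ_p² χ̄(p)` into the real spectral datum `|μ_p|²` that a census
  encloses. It USES the clause `∃ z, u z ≠ 0` — the hypothesis that
  `Negative.quarterFingerprintDeficit_false_without_nonzero` (landed, cdisprove) shows to be load-bearing:
  with `u = 0` every `μ` is an eigenvalue and the identity fails.
* `stub_windowMultiplicityOne` (COUNT — certified Selberg trace formula on `(Γ₀(1951), χ)` with a test
  function `h ≥ 0` on the spectrum, `h ≥ 1` on the window, geometric side `< 2`; BLS 2020's evaluator at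
  `N = 1951` with the Artin prediction no longer subtracted; verdict class computation): for `χ` of order 5
  the window carries at most ONE joint `{Δ, T_p (p ≤ 13)}`-eigenline — any two window joint eigenforms are
  proportional. No fingerprint enters. Plausible whether or not Langlands holds (prime level, primitive
  `χ`: no oldforms, no residual spectrum; Plancherel mass of `|r| ≤ 0.1` at covolume `1952π/3` is ≈ 0.03
  generic forms per character; reciprocity predicts exactly one `λ = 1/4` newform per order-5 `χ`, whose
  reflection `u(−z̄) = −u(z)` lies on the same line).
* `stub_loneFormOffPrint` (IDENTIFY — Hejhal's linear system for the lone window form + joint `{Δ, T_p}`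
  quasimode boxes, BSV 2006 Lemma 3.2 carried to `(Γ₀(N), χ)` as in Child 2022, then rational box
  arithmetic against `Φ ± 1/100`; verdict class computation): a window joint eigenform that is ALONE in
  its character has, at some `p ≤ 13`, real datum `μ_p μ̄_p` at distance `> 1/100` from `Φ`. THIS is where
  the bet lives: the lead's (uncertified, 12-digit) Hejhal sighting `SightingHejhalR0.md` says the lone
  window form of each order-5 `χ` IS the fingerprinted even-icosahedral newform, i.e. this stub is
  numerically false — consistent with the item's standing "refuted by evidence" note and with the landed
  `Negative.QuarterFingerprintDeficit_false_of_EvenIcosahedralMaassFormAt1951 : H → ¬C1`. The skeleton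
  records which piece of C1 the sighting contradicts; stubs 1–2 survive it.

Shape (for `ledger skeleton check` / `#h21_check_skeleton`): each stub is `theorem stub_<name> (binders) :
<conclusion> := by sorry` over the named predicates `Φ P₀ IsForm Tp IsWindowForm IsJointEigen` of §0 (verbatim
copies of the crux's `let`s; `deficit_iff` is `Iff.rfl`); `_Goal.stub_<name> : Prop := type_of% @stub_<name>` names that
statement; the composition `QuarterFingerprintDeficit_of (h₁ : _Goal.stub_heckeReality)
(h₂ : _Goal.stub_windowMultiplicityOne) (h₃ : _Goal.stub_loneFormOffPrint) : QuarterFingerprintDeficit` is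
proved without `sorry` and concludes the route decl BY NAME; the last `example` feeds the three stubs to it.

Disproof used: `quarterFingerprintDeficit_false_without_nonzero` (nonzero consumed in stubs 1, 2, 3 — no
stub is an instance of the refuted `QuarterFingerprintDeficitWithoutNonzero`); `not_deficit_iff_windowSighting`
(Disproof §0): a refutation of stub 3 at an alone form is literally a `WindowSighting`; `ExactSighting` /
`H → ¬C1`: an exact sighting on an order-5 `χ` whose window is simple (stub 2) falsifies stub 3 via stub 1.
-/

set_option linter.dupNamespace false

noncomputable section

namespace Summit.Langlands.Langlands.Cruxes.QuarterFingerprintDeficit.Birth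

open Summit.Langlands.Langlands.Theses.QuarterDeficit1951
open scoped BigOperators ComplexConjugate

/-! ## 0. Named copies of the crux's `let`s (for the composition proof; `deficit_iff` is `Iff.rfl`) -/

/-- The projective fingerprint set `Φ = {tr²/det of elements of order 1,2,3,5} = {4,0,1,(3±√5)/2}`. [folklore] -/
def Φ : Set ℂ := {0, 1, 4, (((3 + Real.sqrt 5) / 2 : ℝ) : ℂ), (((3 - Real.sqrt 5) / 2 : ℝ) : ℂ)}

/-- The six test primes. [folklore] -/
def P₀ : Finset ℕ := {2, 3, 5, 7, 11, 13}

/-- `IsForm χ u λ`: `u` bounded `C²`, `Δu + λu = 0`, `Γ₀(1951)`-automorphic with nebentypus `χ(d)`, zero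
constant terms at `∞` (width 1) and at `0` (period 1951 in `z ↦ S•z`). Verbatim from the route decl. [folklore] -/
def IsForm (χ : DirichletCharacter ℂ 1951) (u : UpperHalfPlane → ℂ) (lam : ℝ) : Prop :=
  Literature.NumberTheory.Automorphic.IsC2 u ∧
  (∀ z, Literature.NumberTheory.Automorphic.hypLaplacian u z + (lam : ℂ) * u z = 0) ∧
  (∀ γ : Matrix.SpecialLinearGroup (Fin 2) ℤ, γ ∈ CongruenceSubgroup.Gamma0 1951 →
    ∀ z : UpperHalfPlane, u (γ • z) = χ ((γ 1 1 : ℤ) : ZMod 1951) * u z) ∧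
  (∀ y : ℝ, 0 < y → ∫ x in (0 : ℝ)..1, u (UpperHalfPlane.ofComplex (x + y * Complex.I)) = 0) ∧
  (∀ y : ℝ, 0 < y →
    ∫ x in (0 : ℝ)..1951, u (ModularGroup.S • UpperHalfPlane.ofComplex (x + y * Complex.I)) = 0) ∧
  (∃ C : ℝ, ∀ z, ‖u z‖ ≤ C)

/-- The crux's unitary Hecke operator with nebentypus, `T_p u (z) = p^{-1/2} (Σ_{b mod p} u((z+b)/p) + χ(p) u(pz))`
(Booker–Lee–Strömbergsson 2020 §1.1 at `n = p`). Verbatim from the route decl. [folklore] -/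
def Tp (χ : DirichletCharacter ℂ 1951) (p : ℕ) (u : UpperHalfPlane → ℂ) (z : UpperHalfPlane) : ℂ :=
  ((Real.sqrt p : ℝ) : ℂ)⁻¹ *
    ((∑ b ∈ Finset.range p, u (UpperHalfPlane.ofComplex (((z : ℂ) + b) / p))) +
      χ (p : ZMod 1951) * u (UpperHalfPlane.ofComplex ((p : ℂ) * z)))

/-- A WINDOW FORM: a nonzero form in the spectral window `|λ − 1/4| ≤ 1/100`. [folklore] -/
def IsWindowForm (χ : DirichletCharacter ℂ 1951) (u : UpperHalfPlane → ℂ) (lam : ℝ) : Prop :=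
  IsForm χ u lam ∧ (∃ z, u z ≠ 0) ∧ |lam - 1 / 4| ≤ 1 / 100

/-- Joint `T_p`-eigenfunction at the six test primes (eigenvalues unnamed). [folklore] -/
def IsJointEigen (χ : DirichletCharacter ℂ 1951) (u : UpperHalfPlane → ℂ) : Prop :=
  ∀ p ∈ P₀, ∃ μ : ℂ, ∀ z, Tp χ p u z = μ * u z

/-- The crux unfolded over the named predicates (definitional). [folklore] -/
theorem deficit_iff : QuarterFingerprintDeficit ↔
    ∀ χ : DirichletCharacter ℂ 1951, orderOf χ = 5 → ¬ ∃ (u : UpperHalfPlane → ℂ) (lam : ℝ),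
    IsForm χ u lam ∧ (∃ z, u z ≠ 0) ∧ |lam - 1 / 4| ≤ 1 / 100 ∧
    ∀ p ∈ P₀, ∃ μ φ : ℂ, φ ∈ Φ ∧ (∀ z, Tp χ p u z = μ * u z) ∧
      ‖μ ^ 2 * (starRingEnd ℂ) (χ (p : ZMod 1951)) - φ‖ ≤ 1 / 100 := Iff.rfl

/-! ## 1. The three stubs (binder form over the named predicates of §0; `_Goal.stub_x` in §2 is the closed statement) -/

/-- **STUB 1 — Hecke reality** (`T_p* = χ̄(p) T_p` for `p ∤ 1951` on `L²(Γ₀(1951)\ℍ, χ)`): for a nonzero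
bounded `C²` automorphic form with nebentypus `χ` (any `χ mod 1951`) that is a `T_p`-eigenfunction
(`p ∈ {2,…,13}`), the eigenvalue satisfies `μ² χ̄(p) = μ μ̄` (equivalently `μ χ̄(p) = μ̄`; so `μ² χ̄(p) = |μ|²`).
Proof route: `u` bounded and `|u|` `Γ₀(1951)`-invariant (`|χ| = 1`) ⇒ `u ∈ L²` of a fundamental domain of
finite covolume; `‖u‖₂ > 0` since `u` is continuous and `u z ≠ 0` somewhere; `⟨T_p u, u⟩ = χ(p) ⟨u, T_p u⟩` by
unfolding the double coset `Γ₀(N) diag(1,p) Γ₀(N)`; hence `μ ‖u‖² = χ(p) μ̄ ‖u‖²`. (For odd `χ` the automorphy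
clause at `−I` forces `u ≡ 0` — `Negative.eq_zero_of_automorphic_of_apply_neg_one` — so the statement is
vacuous there; order-5 characters are even.) It USES `hne` (cf. `Negative.quarterFingerprintDeficit_false_without_nonzero`:
for `u = 0` every `μ` is an eigenvalue and the identity fails). Size L–XL: the Petersson pairing on `Γ₀(N)\ℍ`
is not in Mathlib. [cite: DiamondShurman2005, Thm 5.5.3] [cite: Iwaniec2002, Thm 6.20] -/
theorem stub_heckeReality (χ : DirichletCharacter ℂ 1951) (u : UpperHalfPlane → ℂ) (lam : ℝ)
    (hform : IsForm χ u lam) (hne : ∃ z, u z ≠ 0) (p : ℕ) (hp : p ∈ P₀) (μ : ℂ)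
    (hT : ∀ z, Tp χ p u z = μ * u z) :
    μ ^ 2 * (starRingEnd ℂ) (χ (p : ZMod 1951)) = μ * (starRingEnd ℂ) μ := by
  sorry

/-- **STUB 2 — COUNT: window multiplicity one** (certified Selberg trace formula on `(Γ₀(1951), χ)` with a
test function `h ≥ 0` on the spectrum, `h ≥ 1` on the window, geometric side `< 2` per character — BLS 2020's
evaluator at `N = 1951`, the count no longer conditional on Artin; verdict class computation): for `χ` of
order `5`, any two WINDOW FORMS (`IsWindowForm`: `IsForm`, nonzero, `|λ − 1/4| ≤ 1/100`) that are joint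
`T_p`-eigenfunctions for `p ≤ 13` (`IsJointEigen`) are proportional — the window carries at most one joint
eigenline. No fingerprint enters; plausible in both worlds (one reciprocity-predicted `λ = 1/4` newform per
character, its reflection `u(−z̄) = −u` on the same line; generic Plancherel mass of `|r| ≤ 0.1` ≈ 0.03 per
character). Why it might fail: a generic low-lying form with `|r| ≤ 0.1` on some order-5 character, or a
second eigenline hiding in the joint `p ≤ 13` data. It USES the nonzero clause inside `IsWindowForm`
(`u₁ = 0`, `u₂ ≠ 0` would break proportionality). [cite: BookerLeeStrombergsson2020, Thm 2 and §5]
[cite: BookerStrombergsson2007, §1] -/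
theorem stub_windowMultiplicityOne (χ : DirichletCharacter ℂ 1951) (hχ : orderOf χ = 5)
    (u₁ : UpperHalfPlane → ℂ) (lam₁ : ℝ) (u₂ : UpperHalfPlane → ℂ) (lam₂ : ℝ)
    (h₁ : IsWindowForm χ u₁ lam₁) (he₁ : IsJointEigen χ u₁) (h₂ : IsWindowForm χ u₂ lam₂)
    (he₂ : IsJointEigen χ u₂) :
    ∃ c : ℂ, ∀ z, u₂ z = c * u₁ z := by
  sorry

/-- **STUB 3 — IDENTIFY: the lone window form is off-print** (Hejhal's linear system for the lone window
form + joint `{Δ, T_p}` quasimode boxes of half-width `≤ 10⁻³`, BSV 2006 Lemma 3.2 carried to `(Γ₀(N), χ)`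
as in Child 2022, then rational box arithmetic against `Φ ± 1/100`; verdict class computation): for `χ` of
order `5`, a window joint eigenform `u` such that EVERY window joint eigenform of `χ` is proportional to `u`
has some `p ∈ {2,…,13}` at which the real datum `μ_p μ̄_p` lies at distance `> 1/100` from `Φ`. THE BET:
numerically false per the lead's Hejhal sighting (`SightingHejhalR0.md`: the lone `λ = 1/4` form of each
order-5 `χ` has `|μ_p|² ∈ Φ` to `10⁻¹²` at all six primes) — a certified version of that sighting refutes
this stub and, through `QuarterFingerprintDeficit_of`, locates the failure of C1 here.
[cite: BookerStrombergssonVenkatesh2006, Lemma 3.2] [cite: Child2022, Thm 1] -/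
theorem stub_loneFormOffPrint (χ : DirichletCharacter ℂ 1951) (hχ : orderOf χ = 5)
    (u : UpperHalfPlane → ℂ) (lam : ℝ) (hu : IsWindowForm χ u lam) (he : IsJointEigen χ u)
    (halone : ∀ (u' : UpperHalfPlane → ℂ) (lam' : ℝ), IsWindowForm χ u' lam' → IsJointEigen χ u' →
      ∃ c : ℂ, ∀ z, u' z = c * u z) :
    ∃ p ∈ P₀, ∀ μ : ℂ, (∀ z, Tp χ p u z = μ * u z) →
      ∀ φ ∈ Φ, (1 / 100 : ℝ) < ‖μ * (starRingEnd ℂ) μ - φ‖ := by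
  sorry

/-! ## 2. The stub statements as named propositions (the composition's hypotheses, by name)

The namespace `_Goal` is an internal name on purpose: audits that list a file's declarations by short name then find
the `stub_*` THEOREMS (with their full signatures), while `#h21_check_skeleton` accepts the hypotheses of
`QuarterFingerprintDeficit_of` by the stub names they carry. Each `_Goal.stub_x` is `type_of% @stub_x` — no text is
duplicated and no `sorry` is inherited (a type mentions no proof). -/

namespace _Goal

/-- The statement of `stub_heckeReality`, as a named `Prop` (literally its type). [folklore] -/
def stub_heckeReality : Prop :=
  type_of% @Summit.Langlands.Langlands.Cruxes.QuarterFingerprintDeficit.Birth.stub_heckeReality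

/-- The statement of `stub_windowMultiplicityOne`, as a named `Prop` (literally its type). [folklore] -/
def stub_windowMultiplicityOne : Prop :=
  type_of% @Summit.Langlands.Langlands.Cruxes.QuarterFingerprintDeficit.Birth.stub_windowMultiplicityOne

/-- The statement of `stub_loneFormOffPrint`, as a named `Prop` (literally its type). [folklore] -/
def stub_loneFormOffPrint : Prop :=
  type_of% @Summit.Langlands.Langlands.Cruxes.QuarterFingerprintDeficit.Birth.stub_loneFormOffPrint

end _Goal

/-- The three named statements over this file's named predicates (definitional unfolding of the `let`s). [folklore] -/
theorem goals_iff :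
    (_Goal.stub_heckeReality ↔
      ∀ (χ : DirichletCharacter ℂ 1951) (u : UpperHalfPlane → ℂ) (lam : ℝ),
        IsForm χ u lam → (∃ z, u z ≠ 0) →
          ∀ p ∈ P₀, ∀ μ : ℂ, (∀ z, Tp χ p u z = μ * u z) →
            μ ^ 2 * (starRingEnd ℂ) (χ (p : ZMod 1951)) = μ * (starRingEnd ℂ) μ) ∧
    (_Goal.stub_windowMultiplicityOne ↔
      ∀ χ : DirichletCharacter ℂ 1951, orderOf χ = 5 →
        ∀ (u₁ : UpperHalfPlane → ℂ) (lam₁ : ℝ) (u₂ : UpperHalfPlane → ℂ) (lam₂ : ℝ),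
          IsWindowForm χ u₁ lam₁ → IsJointEigen χ u₁ → IsWindowForm χ u₂ lam₂ → IsJointEigen χ u₂ →
            ∃ c : ℂ, ∀ z, u₂ z = c * u₁ z) ∧
    (_Goal.stub_loneFormOffPrint ↔
      ∀ χ : DirichletCharacter ℂ 1951, orderOf χ = 5 →
        ∀ (u : UpperHalfPlane → ℂ) (lam : ℝ), IsWindowForm χ u lam → IsJointEigen χ u →
          (∀ (u' : UpperHalfPlane → ℂ) (lam' : ℝ), IsWindowForm χ u' lam' → IsJointEigen χ u' →
              ∃ c : ℂ, ∀ z, u' z = c * u z) →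
            ∃ p ∈ P₀, ∀ μ : ℂ, (∀ z, Tp χ p u z = μ * u z) →
              ∀ φ ∈ Φ, (1 / 100 : ℝ) < ‖μ * (starRingEnd ℂ) μ - φ‖) :=
  ⟨Iff.rfl, Iff.rfl, Iff.rfl⟩

/-! ## 3. The composition (kernel-checked, no `sorry`): REALITY → COUNT → IDENTIFY → C1 by name -/

/-- **C1 from the three stubs.** A crux witness `(u, λ)` for an order-5 `χ` is a window joint eigenform;
COUNT makes it the only eigenline in the window; IDENTIFY gives a prime `p ≤ 13` with `μ_p μ̄_p` off-print;
REALITY rewrites `μ_p μ̄_p = μ_p² χ̄(p)`, contradicting the witness's fingerprint clause at `p`. The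
hypotheses are, by name, the statements of `stub_heckeReality`, `stub_windowMultiplicityOne`,
`stub_loneFormOffPrint`; the conclusion is the route decl. [folklore] -/
theorem QuarterFingerprintDeficit_of (h₁ : _Goal.stub_heckeReality) (h₂ : _Goal.stub_windowMultiplicityOne)
    (h₃ : _Goal.stub_loneFormOffPrint) : QuarterFingerprintDeficit := by
  obtain ⟨e₁, e₂, e₃⟩ := goals_iff
  have hReality := e₁.mp h₁
  have hCount := e₂.mp h₂
  have hIdentify := e₃.mp h₃
  rw [deficit_iff]
  rintro χ hχ ⟨u, lam, hform, hne, hwin, hfp⟩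
  -- the witness is a window joint eigenform
  have hwf : IsWindowForm χ u lam := ⟨hform, hne, hwin⟩
  have heig : IsJointEigen χ u := fun p hp => by
    obtain ⟨μ, φ, -, hT, -⟩ := hfp p hp
    exact ⟨μ, hT⟩
  -- COUNT: it is the only joint eigenline in the window of χ
  have halone : ∀ (u' : UpperHalfPlane → ℂ) (lam' : ℝ), IsWindowForm χ u' lam' → IsJointEigen χ u' →
      ∃ c : ℂ, ∀ z, u' z = c * u z :=
    fun u' lam' hwf' heig' => hCount χ hχ u lam u' lam' hwf heig hwf' heig'
  -- IDENTIFY: some test prime puts the real datum μ μ̄ off-print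
  obtain ⟨p, hp, hfar⟩ := hIdentify χ hχ u lam hwf heig halone
  obtain ⟨μ, φ, hφ, hT, hnear⟩ := hfp p hp
  -- REALITY: μ μ̄ = μ² χ̄(p), so the witness's fingerprint clause at p is violated
  have hreal := hReality χ u lam hform hne p hp μ hT
  have hlt : (1 / 100 : ℝ) < ‖μ ^ 2 * (starRingEnd ℂ) (χ (p : ZMod 1951)) - φ‖ := by
    rw [hreal]
    exact hfar μ hT φ hφ
  exact absurd hnear (not_le.mpr hlt)

/-- By-name sanity check (an `example`, so it is not a declaration of the file): the three stubs feed the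
composition as they stand. -/
example : QuarterFingerprintDeficit :=
  QuarterFingerprintDeficit_of stub_heckeReality stub_windowMultiplicityOne stub_loneFormOffPrint

end Summit.Langlands.Langlands.Cruxes.QuarterFingerprintDeficit.Birth

end
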